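/-
Origin: expansion seat `planner-pub-hodgecm-pv03-g5-0`, handover #2 2026-08-18T08:47:36Z (`HOME/pub-hodgecm-pv03-g5/lean/Pv03g5/ThetaPeriod.lean`, md5 c6c35e11, 351 lines);
landed by the gen-7 packager in gate run 27 as `HodgeCM/Model/ToyG2/ThetaPeriod.lean` (import ^import Pv03g5\.→import HodgeCM.Model.ToyG2. ×1).
-/
import Mathlib
import Summits.HodgeConjecture.HodgeCM.Model.ToyG2.ThetaUiso_2
import Summits.HodgeConjecture.HodgeCM.Model.ToyG2.Good

/-!
# (R1) The quadrilinear period of `P(L, ι₁)` on single eigenvectors, in Universe language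

Companion of `ThetaUiso` (R2-a).  For the period block `P(L, ι₁) = ∏_q M_{Θ_q}` of `toyUniverse₃ d t`
(`pms L ι₁ V Γ`, trace `tr₄ = ℓ = ∑_q ℓ_{Θ_q} ∘ ⋀⁴ pr_q`, toy-g2 `PeriodLeaf` / `Universe3`) and the single
eigenvectors `E_{k,i,τ} = eCls k i τ ∈ H¹(P(L, ι₁), ℂ)` of `ThetaUiso`, this file computes the quadrilinear period
`tr_ℂ((E₀ ∪ E₁) ∪ (E₂ ∪ E₃))` = `trC (pms) 4 (quadC (pms) E₀ E₁ E₂ E₃)`: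

* `trC_eq_baseC₃` : `trC (pms L ι₁ V Γ) 4 y = ℓ_ℂ (Θ₄ y)` (`baseC` of toy-g2 `EigenForms`);
* `trC_quadC_form1₃` : on degree-one classes `form1 a, …` it is the alternating form `ℓ_ℂ (a, b, c, e)`
  (`baseCA`), by gen-1 `Obj.theta_quad`;
* `baseCA_leaf` : `ℓ_ℂ = ∑_q (ℓ_{Θ_q})_ℂ ∘ (pr_q)^{⊗4}` (toy-g2 `baseC_sum`, `baseC_comp_map`);
* `baseCA_leaf_eVec_same` / `baseCA_leaf_eVec_mixed` : four single eigenvectors from ONE block `k` have period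
  `(ℓ_{Θ_k})_ℂ (e_{s₀,τ₀}, …, e_{s₃,τ₃})` — the value table of toy-g2 `EigenForms` (`baseCA_ell_sorted`,
  `baseCA_ell_pair_eq`, `baseC_ell_mono_eq_zero`) then applies verbatim — and four single eigenvectors meeting
  TWO different blocks have period `0`;
* `trC_quadC_eCls_same₃`, `trC_quadC_eCls_mixed₃`, `trC_quadC_eCls_sorted₃`, `trC_quadC_eCls_pair₃`,
  `trC_quadC_eCls_eq_zero₃` : the same statements in the language of `toyUniverse₃ d t` (R1 of toy-g2 DESIGN.md
  §8/§9: "period table in Universe language");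
* `conj_eCls` : `conj E_{k,i,τ} = E_{k,i,τ̄}` (gen-1 `conj_eps`); `eCls_mem_H10₃` : `E_{k,i,τ} ∈ H^{1,0}(P(L, ι₁))`
  for holomorphic indices `τ|_L ∈ Θ_{k,i}` (`eB_mem_F1`, `hol_ix`, `isHodge_leafIncl`), and conversely
  `F1_leaf_eq_span` / `H10_eq_span₃` : `F¹ H¹(P(L, ι₁))` resp. `H^{1,0}(P(L, ι₁))` IS THE SPAN of the
  holomorphic single eigenvectors (`F1_prodFam_le` : `F¹` of an iterated product is generated blockwise;
  gen-1 `F1_eq_span`, `ix_surjective`) — the `H10` line of (R2-b); and the PERIOD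
  `U.period (pms) ![E₀, E₁, E₂, E₃] = tr_ℂ((E₀ ∪ E₁) ∪ (conj E₂ ∪ conj E₃))` — the shape consumed by
  `ThetaRealisation.inner_Λ` (R3, Gram identity) — on single eigenvectors: `period_eCls_same₃` (one block: the
  `EigenForms` table with `τ₂, τ₃ ↦ τ̄₂, τ̄₃`), `period_eCls_mixed₃` (two blocks: `0`).

Everything is kernel-proved from the tree; no citation, nothing posited.
-/

open scoped TensorProduct
open HodgeCM.Toy HodgeCM.Toy.CMPresentation exteriorPower NumberField.ComplexEmbedding
open Literature.AlgebraicGeometry.Motives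

namespace HodgeCM.ToyG2.ThetaUiso

noncomputable section

/-! ### §1 The complexified period functional of the leaf, blockwise -/
section Leaf

variable {L : CMField} (ι₁ : L →+* ℂ) (d t : ℚ)

/-- `ℓ_ℂ (v₀, v₁, v₂, v₃) = ∑_q (ℓ_{Θ_q})_ℂ (pr_q v₀, …, pr_q v₃)` -/
theorem baseCA_leaf (v : Fin 4 → (PO ι₁ d t).LC) :
    baseCA (PO ι₁ d t) (pLeafOf L ι₁ d t).ℓ v
      = ∑ q, baseCA (PP L (ΘOf L ι₁ q)) (ellLin L (ΘOf L ι₁ q) (ξOf L ι₁ q) d t)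
          (fun a => (leafProj ι₁ d t q).baseChange ℂ (v a)) := by
  show baseC (prodFam (nQ L ι₁) (bfam L ι₁))
      (sumForm (nQ L ι₁) (bfam L ι₁) fun q => ellLin L (ΘOf L ι₁ q) (ξOf L ι₁ q) d t) (ιMulti ℂ 4 v)
    = ∑ q, baseC (PP L (ΘOf L ι₁ q)) (ellLin L (ΘOf L ι₁ q) (ξOf L ι₁ q) d t)
        (ιMulti ℂ 4 fun a => (leafProj ι₁ d t q).baseChange ℂ (v a))
  rw [sumForm, baseC_sum, LinearMap.sum_apply]
  refine Finset.sum_congr rfl fun q _ => ?_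
  rw [baseC_comp_map, LinearMap.comp_apply, exteriorPower.map_apply_ιMulti]
  rfl

/-- SAME BLOCK: four single eigenvectors of block `k`, in slots `s a` with characters `τ a`, have period
`(ℓ_{Θ_k})_ℂ (e_{s 0, τ 0}, …, e_{s 3, τ 3})` — an entry of the toy-g2 `EigenForms` value table. -/
theorem baseCA_leaf_eVec_same (k : Fin (nQ L ι₁)) (s : Fin 4 → Fin 4) (τ : Fin 4 → (FK L →+* ℂ)) :
    baseCA (PO ι₁ d t) (pLeafOf L ι₁ d t).ℓ (fun a => eVec ι₁ d t k (s a) (τ a))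
      = baseCA (PP L (ΘOf L ι₁ k)) (ellLin L (ΘOf L ι₁ k) (ξOf L ι₁ k) d t)
          (fun a => (PP L (ΘOf L ι₁ k)).eB (ix L (ΘOf L ι₁ k) (τ a) (s a))) := by
  rw [baseCA_leaf, Finset.sum_eq_single k]
  · congr 1
    funext a
    rw [eVec_eq, leafProj_baseChange_leafIncl_self]
  · intro q _ hq
    refine AlternatingMap.map_coord_zero _ (0 : Fin 4) ?_
    show (leafProj ι₁ d t q).baseChange ℂ (eVec ι₁ d t k (s 0) (τ 0)) = 0
    rw [eVec_eq, leafProj_baseChange_leafIncl_of_ne ι₁ d t hq]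
  · exact fun hk => absurd (Finset.mem_univ k) hk

/-- MIXED BLOCKS: four single eigenvectors meeting two different blocks have period `0`. -/
theorem baseCA_leaf_eVec_mixed (k : Fin 4 → Fin (nQ L ι₁)) (s : Fin 4 → Fin 4)
    (τ : Fin 4 → (FK L →+* ℂ)) {a b : Fin 4} (h : k a ≠ k b) :
    baseCA (PO ι₁ d t) (pLeafOf L ι₁ d t).ℓ (fun c => eVec ι₁ d t (k c) (s c) (τ c)) = 0 := by
  rw [baseCA_leaf]
  refine Finset.sum_eq_zero fun q _ => ?_
  by_cases hqa : q = k a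
  · have hqb : q ≠ k b := hqa ▸ h
    refine AlternatingMap.map_coord_zero _ b ?_
    show (leafProj ι₁ d t q).baseChange ℂ (eVec ι₁ d t (k b) (s b) (τ b)) = 0
    rw [eVec_eq, leafProj_baseChange_leafIncl_of_ne ι₁ d t hqb]
  · refine AlternatingMap.map_coord_zero _ a ?_
    show (leafProj ι₁ d t q).baseChange ℂ (eVec ι₁ d t (k a) (s a) (τ a)) = 0
    rw [eVec_eq, leafProj_baseChange_leafIncl_of_ne ι₁ d t hqa]

/-- the `![…]`-family of four single eigenvectors of one block as a `fun`-family -/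
lemma vec4_eVec (k : Fin (nQ L ι₁)) (s : Fin 4 → Fin 4) (τ : Fin 4 → (FK L →+* ℂ)) :
    ![eVec ι₁ d t k (s 0) (τ 0), eVec ι₁ d t k (s 1) (τ 1), eVec ι₁ d t k (s 2) (τ 2),
        eVec ι₁ d t k (s 3) (τ 3)]
      = fun a => eVec ι₁ d t k (s a) (τ a) := by
  funext a
  fin_cases a <;> rfl

/-- the same with block indices varying -/
lemma vec4_eVec' (k : Fin 4 → Fin (nQ L ι₁)) (s : Fin 4 → Fin 4) (τ : Fin 4 → (FK L →+* ℂ)) :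
    ![eVec ι₁ d t (k 0) (s 0) (τ 0), eVec ι₁ d t (k 1) (s 1) (τ 1), eVec ι₁ d t (k 2) (s 2) (τ 2),
        eVec ι₁ d t (k 3) (s 3) (τ 3)]
      = fun a => eVec ι₁ d t (k a) (s a) (τ a) := by
  funext a
  fin_cases a <;> rfl

variable (k : Fin (nQ L ι₁)) (i : Fin 4)

/-- conjugation commutes with the slot maps (they are base changes of rational maps) -/
lemma conj_slotC (y : ℂ ⊗[ℚ] FK L) :
    HodgeStructure.conj (slotC ι₁ d t k i y) = slotC ι₁ d t k i (HodgeStructure.conj y) := by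
  simp only [slotC, LinearMap.coe_comp, Function.comp_apply, HodgeStructure.conj_baseChange]

/-- **conjugate of a single eigenvector**: `conj E_{k,i,τ} = E_{k,i,τ̄}` -/
theorem conj_eCls (τ' : FK L →+* ℂ) :
    HodgeStructure.conj (eCls ι₁ d t k i τ') = eCls ι₁ d t k i (conjugate τ') := by
  rw [eCls, eCls, conj_slotC, conj_eps]

/-- a single eigenvector with HOLOMORPHIC index (`τ|_L ∈ Θ_{k,i}`) lies in `F¹` of the leaf lattice -/
theorem eVec_mem_F1 {τ' : FK L →+* ℂ} (hτ : τ'.comp (eK L : L →+* FK L) ∈ (ΘOf L ι₁ k i).1) :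
    eVec ι₁ d t k i τ' ∈ (PO ι₁ d t).F1 := by
  rw [eVec_eq]
  exact isHodge_leafIncl ι₁ d t k
    ⟨_, (PP L (ΘOf L ι₁ k)).eB_mem_F1 ((hol_ix L (ΘOf L ι₁ k) τ' i).mpr hτ), rfl⟩

end Leaf

/-! ### §1b `F¹` of an iterated product is generated blockwise; `F¹(P(L, ι₁))` = span of the
holomorphic single eigenvectors -/
section F1

/-- `F¹(X × Y) ⊆ incl₁(F¹ X) + incl₂(F¹ Y)` -/
lemma F1_prod_le (X Y : Obj) :
    (X.prod Y).F1 ≤ X.F1.map ((X.inlL Y).baseChange ℂ) ⊔ Y.F1.map ((X.inrL Y).baseChange ℂ) := by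
  refine Submodule.span_le.mpr ?_
  rintro x ⟨i, τ, hτ, rfl⟩
  rcases i with i | j
  · exact Submodule.mem_sup_left
      ⟨X.eT i τ, Submodule.subset_span ⟨i, τ, hτ, rfl⟩, Obj.baseChange_inlL_eT i τ⟩
  · exact Submodule.mem_sup_right
      ⟨Y.eT j τ, Submodule.subset_span ⟨j, τ, hτ, rfl⟩, Obj.baseChange_inrL_eT j τ⟩

/-- `F¹(∏ₖ Bₖ) ⊆ Σₖ inclₖ(F¹ Bₖ)` -/
theorem F1_prodFam_le : ∀ (m : ℕ) (B : Fin m → Obj),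
    (prodFam m B).F1 ≤ ⨆ k, (B k).F1.map ((inclFam m B k).baseChange ℂ)
  | 0, B => by
      refine Submodule.span_le.mpr ?_
      rintro x ⟨i, -, -, -⟩
      exact i.elim
  | m + 1, B => by
      refine (F1_prod_le _ _).trans (sup_le ?_ ?_)
      · rw [← inclFam_zero]
        exact le_iSup (fun k => (B k).F1.map ((inclFam (m + 1) B k).baseChange ℂ)) 0
      · refine (Submodule.map_mono (F1_prodFam_le m _)).trans ?_
        rw [Submodule.map_iSup]
        refine iSup_le fun k' => ?_
        rw [← Submodule.map_comp, ← LinearMap.baseChange_comp, ← inclFam_succ]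
        exact le_iSup (fun k => (B k).F1.map ((inclFam (m + 1) B k).baseChange ℂ)) k'.succ

variable {L : CMField} (ι₁ : L →+* ℂ) (d t : ℚ)

/-- **`F¹ H¹(P(L, ι₁))` is the span of the HOLOMORPHIC single eigenvectors** `e_{k,i,τ}`, `τ|_L ∈ Θ_{k,i}`. -/
theorem F1_leaf_eq_span :
    (PO ι₁ d t).F1 = Submodule.span ℂ
      {v | ∃ (k : Fin (nQ L ι₁)) (i : Fin 4) (τ' : FK L →+* ℂ),
        τ'.comp (eK L : L →+* FK L) ∈ (ΘOf L ι₁ k i).1 ∧ v = eVec ι₁ d t k i τ'} := by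
  refine le_antisymm ?_ (Submodule.span_le.mpr ?_)
  · refine (F1_prodFam_le (nQ L ι₁) (blockFam L ι₁)).trans (iSup_le fun k => ?_)
    show ((PP L (ΘOf L ι₁ k)).F1).map ((leafIncl ι₁ d t k).baseChange ℂ) ≤ _
    rw [(PP L (ΘOf L ι₁ k)).F1_eq_span, Submodule.map_span, Submodule.span_le]
    rintro v ⟨w, ⟨s, hs, rfl⟩, rfl⟩
    obtain ⟨a, τ', rfl⟩ := ix_surjective L (ΘOf L ι₁ k) s
    exact Submodule.subset_span
      ⟨k, a, τ', (hol_ix L (ΘOf L ι₁ k) τ' a).mp hs, (eVec_eq ι₁ d t k a τ').symm⟩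
  · rintro v ⟨k, i, τ', hτ, rfl⟩
    exact eVec_mem_F1 ι₁ d t k i hτ

end F1

/-! ### §2 In the language of `toyUniverse₃ d t` -/
section U₃

variable (d t : ℚ) {L : CMField} (ι₁ : L →+* ℂ) {V : HermSpace3 L ι₁} (Γ : Level V)

/-- the complexified trace of the period surface in degree 4 is `ℓ_ℂ ∘ Θ₄` -/
theorem trC_eq_baseC₃ (y : (toyUniverse₃ d t).CohC ((toyUniverse₃ d t).pms L ι₁ V Γ) 4) :
    (toyUniverse₃ d t).trC ((toyUniverse₃ d t).pms L ι₁ V Γ) 4 y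
      = baseC (PO ι₁ d t) (pLeafOf L ι₁ d t).ℓ ((PO ι₁ d t).Θ 4 y) := by
  show (TensorProduct.AlgebraTensorModule.rid ℚ ℂ ℂ)
        (((toyUniverse₃ d t).tr ((toyUniverse₃ d t).pms L ι₁ V Γ) 4).baseChange ℂ y)
      = (TensorProduct.AlgebraTensorModule.rid ℚ ℂ ℂ)
        ((pLeafOf L ι₁ d t).ℓ.baseChange ℂ (((PO ι₁ d t).Θ 4).symm ((PO ι₁ d t).Θ 4 y)))
  rw [LinearEquiv.symm_apply_apply, toyUniverse₃_tr_pms]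
  exact rfl

/-- on degree-one classes the quadrilinear period is the alternating form `ℓ_ℂ` -/
theorem trC_quadC_form1₃ (a b c e : (PO ι₁ d t).LC) :
    (toyUniverse₃ d t).trC ((toyUniverse₃ d t).pms L ι₁ V Γ) 4
        ((toyUniverse₃ d t).quadC ((toyUniverse₃ d t).pms L ι₁ V Γ)
          ((PO ι₁ d t).form1 a) ((PO ι₁ d t).form1 b) ((PO ι₁ d t).form1 c) ((PO ι₁ d t).form1 e))
      = baseCA (PO ι₁ d t) (pLeafOf L ι₁ d t).ℓ ![a, b, c, e] := by
  rw [trC_eq_baseC₃, baseCA_apply]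
  congr 1
  exact Obj.theta_quad (PO ι₁ d t) a b c e

variable (k : Fin (nQ L ι₁))

/-- **SAME BLOCK.** `tr_ℂ((E_{k,s₀,τ₀} ∪ E_{k,s₁,τ₁}) ∪ (E_{k,s₂,τ₂} ∪ E_{k,s₃,τ₃})) = (ℓ_{Θ_k})_ℂ (e_{s₀,τ₀}, …, e_{s₃,τ₃})` -/
theorem trC_quadC_eCls_same₃ (s : Fin 4 → Fin 4) (τ : Fin 4 → (FK L →+* ℂ)) :
    (toyUniverse₃ d t).trC ((toyUniverse₃ d t).pms L ι₁ V Γ) 4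
        ((toyUniverse₃ d t).quadC ((toyUniverse₃ d t).pms L ι₁ V Γ)
          (eCls ι₁ d t k (s 0) (τ 0)) (eCls ι₁ d t k (s 1) (τ 1))
          (eCls ι₁ d t k (s 2) (τ 2)) (eCls ι₁ d t k (s 3) (τ 3)))
      = baseCA (PP L (ΘOf L ι₁ k)) (ellLin L (ΘOf L ι₁ k) (ξOf L ι₁ k) d t)
          (fun a => (PP L (ΘOf L ι₁ k)).eB (ix L (ΘOf L ι₁ k) (τ a) (s a))) := by
  rw [eCls_eq_form1, eCls_eq_form1, eCls_eq_form1, eCls_eq_form1, trC_quadC_form1₃, vec4_eVec,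
    baseCA_leaf_eVec_same]

/-- **MIXED BLOCKS.** Four single eigenvectors meeting two different blocks have quadrilinear period `0`. -/
theorem trC_quadC_eCls_mixed₃ (k : Fin 4 → Fin (nQ L ι₁)) (s : Fin 4 → Fin 4)
    (τ : Fin 4 → (FK L →+* ℂ)) {a b : Fin 4} (h : k a ≠ k b) :
    (toyUniverse₃ d t).trC ((toyUniverse₃ d t).pms L ι₁ V Γ) 4
        ((toyUniverse₃ d t).quadC ((toyUniverse₃ d t).pms L ι₁ V Γ)
          (eCls ι₁ d t (k 0) (s 0) (τ 0)) (eCls ι₁ d t (k 1) (s 1) (τ 1))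
          (eCls ι₁ d t (k 2) (s 2) (τ 2)) (eCls ι₁ d t (k 3) (s 3) (τ 3))) = 0 := by
  rw [eCls_eq_form1, eCls_eq_form1, eCls_eq_form1, eCls_eq_form1, trC_quadC_form1₃, vec4_eVec',
    baseCA_leaf_eVec_mixed ι₁ d t k s τ h]

open scoped Classical in
/-- **SORTED SLOTS** `(0,1,2,3)`: the `T`-term of `ℓ_{Θ_k}` —
`tr_ℂ((E_{k,0,τ₀} ∪ E_{k,1,τ₁}) ∪ (E_{k,2,τ₂} ∪ E_{k,3,τ₃})) = t · τ₀(ξ₂ ξ₃) · [τ₀ = τ₁ = τ̄₂ = τ̄₃]`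
(`ξ = ξOf L ι₁ k` the Riemann system of block `k`). -/
theorem trC_quadC_eCls_sorted₃ (τ : Fin 4 → (FK L →+* ℂ)) :
    (toyUniverse₃ d t).trC ((toyUniverse₃ d t).pms L ι₁ V Γ) 4
        ((toyUniverse₃ d t).quadC ((toyUniverse₃ d t).pms L ι₁ V Γ)
          (eCls ι₁ d t k 0 (τ 0)) (eCls ι₁ d t k 1 (τ 1)) (eCls ι₁ d t k 2 (τ 2)) (eCls ι₁ d t k 3 (τ 3)))
      = (t : ℂ) * (if τ 0 = τ 1 ∧ conjugate (τ 0) = τ 2 ∧ conjugate (τ 0) = τ 3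
          then τ 0 (eK L (ξOf L ι₁ k 2 * ξOf L ι₁ k 3)) else 0) := by
  have h := trC_quadC_eCls_same₃ d t ι₁ Γ k (fun a => a) τ
  dsimp only at h
  rw [h]
  exact baseCA_ell_sorted L (ΘOf L ι₁ k) (ξOf L ι₁ k) d t τ

open scoped Classical in
/-- **PAIRED SLOTS** `(a,a,b,b)`, `a < b`: the `E_a ∧ E_b`-term of `ℓ_{Θ_k}` —
`tr_ℂ((E_{k,a,τ₀} ∪ E_{k,a,τ₁}) ∪ (E_{k,b,τ₂} ∪ E_{k,b,τ₃})) = ellCoef d a b · (2τ₀(ξ_a)[τ₁ = τ̄₀]) · (2τ₂(ξ_b)[τ₃ = τ̄₂])`. -/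
theorem trC_quadC_eCls_pair₃ {a b : Fin 4} (hab : a < b) (τ : Fin 4 → (FK L →+* ℂ)) :
    (toyUniverse₃ d t).trC ((toyUniverse₃ d t).pms L ι₁ V Γ) 4
        ((toyUniverse₃ d t).quadC ((toyUniverse₃ d t).pms L ι₁ V Γ)
          (eCls ι₁ d t k a (τ 0)) (eCls ι₁ d t k a (τ 1)) (eCls ι₁ d t k b (τ 2)) (eCls ι₁ d t k b (τ 3)))
      = (ellCoef d a b : ℂ)
        * ((if τ 1 = conjugate (τ 0) then 2 * τ 0 (eK L (ξOf L ι₁ k a)) else 0)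
          * (if τ 3 = conjugate (τ 2) then 2 * τ 2 (eK L (ξOf L ι₁ k b)) else 0)) := by
  have h := trC_quadC_eCls_same₃ d t ι₁ Γ k ![a, a, b, b] τ
  simp only [v4_0, v4_1, v4_2, v4_3] at h
  rw [h]
  exact baseCA_ell_pair_eq L (ΘOf L ι₁ k) d t (ξOf_conj L ι₁ k) hab τ

/-- **VANISHING** off the admissible slot patterns (no two slots each hit twice, some slot missed). -/
theorem trC_quadC_eCls_eq_zero₃ (s : Fin 4 → Fin 4) (τ : Fin 4 → (FK L →+* ℂ))
    (hE : ∀ a b : Fin 4, a ≠ b →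
      (Finset.univ.filter fun c => s c = a).card < 2 ∨ (Finset.univ.filter fun c => s c = b).card < 2)
    (hT : ∃ c₀ : Fin 4, ∀ c, s c ≠ c₀) :
    (toyUniverse₃ d t).trC ((toyUniverse₃ d t).pms L ι₁ V Γ) 4
        ((toyUniverse₃ d t).quadC ((toyUniverse₃ d t).pms L ι₁ V Γ)
          (eCls ι₁ d t k (s 0) (τ 0)) (eCls ι₁ d t k (s 1) (τ 1))
          (eCls ι₁ d t k (s 2) (τ 2)) (eCls ι₁ d t k (s 3) (τ 3))) = 0 := by
  rw [trC_quadC_eCls_same₃, ← baseC_mono]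
  exact baseC_ell_mono_eq_zero L (ΘOf L ι₁ k) (ξOf L ι₁ k) d t s τ hE hT

variable (i : Fin 4)

/-- **holomorphic single eigenvectors are `(1,0)`-classes**: `E_{k,i,τ} ∈ H^{1,0}(P(L, ι₁))` for `τ|_L ∈ Θ_{k,i}` -/
theorem eCls_mem_H10₃ {τ' : FK L →+* ℂ} (hτ : τ'.comp (eK L : L →+* FK L) ∈ (ΘOf L ι₁ k i).1) :
    eCls ι₁ d t k i τ' ∈ (toyUniverse₃ d t).H10 ((toyUniverse₃ d t).pms L ι₁ V Γ) := by
  have h1 : eCls ι₁ d t k i τ' ∈ (exteriorHodgeData.hs (PO ι₁ d t) 1).F 1 := by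
    rw [exteriorHodgeData.deg1, Obj.F1filt, if_neg (show ¬ ((1 : ℤ) ≤ 0) by norm_num),
      if_pos (show (1 : ℤ) = 1 from rfl)]
    exact ⟨eVec ι₁ d t k i τ', eVec_mem_F1 ι₁ d t k i hτ, rfl⟩
  have h0 : HodgeStructure.conj (eCls ι₁ d t k i τ') ∈ (exteriorHodgeData.hs (PO ι₁ d t) 1).F 0 := by
    rw [exteriorHodgeData.deg1, Obj.F1filt, if_pos (le_refl (0 : ℤ))]
    exact Submodule.mem_top
  exact ((exteriorHodgeData.hs (PO ι₁ d t) 1).mem_piece_iff (by norm_num)).mpr ⟨h1, h0⟩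

/-- **`H^{1,0}(P(L, ι₁))` IS THE SPAN OF THE HOLOMORPHIC SINGLE EIGENVECTORS** `E_{k,i,τ}`, `τ|_L ∈ Θ_{k,i}`
(the `H10` line of toy-g2 DESIGN.md §8 (R2-b)). -/
theorem H10_eq_span₃ :
    (toyUniverse₃ d t).H10 ((toyUniverse₃ d t).pms L ι₁ V Γ) = Submodule.span ℂ
      {ω | ∃ (k : Fin (nQ L ι₁)) (i : Fin 4) (τ' : FK L →+* ℂ),
        τ'.comp (eK L : L →+* FK L) ∈ (ΘOf L ι₁ k i).1 ∧ ω = eCls ι₁ d t k i τ'} := by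
  have hF1 : (exteriorHodgeData.hs (PO ι₁ d t) 1).F 1
      = ((PO ι₁ d t).F1).map (((oneEquiv ℚ (PO ι₁ d t).L).symm.toLinearMap).baseChange ℂ) := by
    rw [exteriorHodgeData.deg1, Obj.F1filt, if_neg (show ¬ ((1 : ℤ) ≤ 0) by norm_num),
      if_pos (show (1 : ℤ) = 1 from rfl)]
  have hF0 : (exteriorHodgeData.hs (PO ι₁ d t) 1).F 0 = ⊤ := by
    rw [exteriorHodgeData.deg1, Obj.F1filt, if_pos (le_refl (0 : ℤ))]
  show (exteriorHodgeData.hs (PO ι₁ d t) 1).piece 1 0 = _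
  rw [HodgeStructure.piece_of_add_eq _ (by norm_num), hF0, HodgeStructure.complexConj_top, inf_top_eq, hF1,
    F1_leaf_eq_span, Submodule.map_span]
  congr 1
  ext ω
  simp only [Set.mem_image, Set.mem_setOf_eq]
  constructor
  · rintro ⟨v, ⟨k, i, τ', hτ, rfl⟩, rfl⟩
    exact ⟨k, i, τ', hτ, rfl⟩
  · rintro ⟨k, i, τ', hτ, rfl⟩
    exact ⟨eVec ι₁ d t k i τ', ⟨k, i, τ', hτ, rfl⟩, rfl⟩

/-- **THE PERIOD on single eigenvectors, SAME BLOCK** (`U.period X ω = tr_ℂ((ω₀ ∪ ω₁) ∪ (conj ω₂ ∪ conj ω₃))`,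
the shape consumed by `ThetaRealisation.inner_Λ`): conjugation replaces `τ₂, τ₃` by `τ̄₂, τ̄₃`, then the
`EigenForms` table of block `k` applies. -/
theorem period_eCls_same₃ (s : Fin 4 → Fin 4) (τ : Fin 4 → (FK L →+* ℂ)) :
    (toyUniverse₃ d t).period ((toyUniverse₃ d t).pms L ι₁ V Γ)
        ![eCls ι₁ d t k (s 0) (τ 0), eCls ι₁ d t k (s 1) (τ 1), eCls ι₁ d t k (s 2) (τ 2), eCls ι₁ d t k (s 3) (τ 3)]
      = baseCA (PP L (ΘOf L ι₁ k)) (ellLin L (ΘOf L ι₁ k) (ξOf L ι₁ k) d t)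
          (fun a => (PP L (ΘOf L ι₁ k)).eB
            (ix L (ΘOf L ι₁ k) (![τ 0, τ 1, conjugate (τ 2), conjugate (τ 3)] a) (s a))) := by
  show (toyUniverse₃ d t).trC ((toyUniverse₃ d t).pms L ι₁ V Γ) 4
      ((toyUniverse₃ d t).quadC ((toyUniverse₃ d t).pms L ι₁ V Γ)
        (eCls ι₁ d t k (s 0) (τ 0)) (eCls ι₁ d t k (s 1) (τ 1))
        (HodgeStructure.conj (V := ↥(⋀[ℚ]^1 (PO ι₁ d t).L)) (eCls ι₁ d t k (s 2) (τ 2)))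
        (HodgeStructure.conj (V := ↥(⋀[ℚ]^1 (PO ι₁ d t).L)) (eCls ι₁ d t k (s 3) (τ 3)))) = _
  rw [conj_eCls, conj_eCls]
  have h := trC_quadC_eCls_same₃ d t ι₁ Γ k s ![τ 0, τ 1, conjugate (τ 2), conjugate (τ 3)]
  simp only [v4_0, v4_1, v4_2, v4_3] at h
  exact h

/-- **THE PERIOD on single eigenvectors, MIXED BLOCKS**: `0`. -/
theorem period_eCls_mixed₃ (k : Fin 4 → Fin (nQ L ι₁)) (s : Fin 4 → Fin 4)
    (τ : Fin 4 → (FK L →+* ℂ)) {a b : Fin 4} (h : k a ≠ k b) :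
    (toyUniverse₃ d t).period ((toyUniverse₃ d t).pms L ι₁ V Γ)
        ![eCls ι₁ d t (k 0) (s 0) (τ 0), eCls ι₁ d t (k 1) (s 1) (τ 1), eCls ι₁ d t (k 2) (s 2) (τ 2),
          eCls ι₁ d t (k 3) (s 3) (τ 3)] = 0 := by
  show (toyUniverse₃ d t).trC ((toyUniverse₃ d t).pms L ι₁ V Γ) 4
      ((toyUniverse₃ d t).quadC ((toyUniverse₃ d t).pms L ι₁ V Γ)
        (eCls ι₁ d t (k 0) (s 0) (τ 0)) (eCls ι₁ d t (k 1) (s 1) (τ 1))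
        (HodgeStructure.conj (V := ↥(⋀[ℚ]^1 (PO ι₁ d t).L)) (eCls ι₁ d t (k 2) (s 2) (τ 2)))
        (HodgeStructure.conj (V := ↥(⋀[ℚ]^1 (PO ι₁ d t).L)) (eCls ι₁ d t (k 3) (s 3) (τ 3)))) = 0
  rw [conj_eCls, conj_eCls]
  have h' := trC_quadC_eCls_mixed₃ d t ι₁ Γ k s ![τ 0, τ 1, conjugate (τ 2), conjugate (τ 3)] h
  simp only [v4_0, v4_1, v4_2, v4_3] at h'
  exact h'

end U₃

end

end HodgeCM.ToyG2.ThetaUiso
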